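import Summits.CriticalPhenomena.CardyFormulaZ2.Theorems.CardyIKTransportIKMixedBoxCrossingDefectStubRowTwist
import Summits.CriticalPhenomena.CardyFormulaZ2.Theorems.CardyIKTransportIKMixedBoxCrossingStubPatternLocality

/-!
# Helper `indepFun_curtain` (curtain independence) for the line `defect-closure-exploration`
# (crux `IKMixedBoxCrossing`, stmt-CriticalPhenomena-5911)

Support file (`--supports stmt-CriticalPhenomena-5911`). Write `ω = (A, B, Pb, Pf, C)` (column signs, row
signs, biased / fair plaquettes, coins). CURTAIN INDEPENDENCE: for every column pattern `S` and every
HONEYCOMB face column `x₀ ∉ S`, under the gauge law `μIK` the colours of the cell columns `≤ x₀` are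
independent of the colours of the cell columns `> x₀`:

  `IndepFun (ω ↦ {v | v 0 ≤ x₀ ∧ v ∈ blackSet S ω}) (ω ↦ {v | x₀ < v 0 ∧ v ∈ blackSet S ω}) μIK`.

Proof (elementary, uniform in `S`; a one-time pad across the face column `x₀`).
* CASE `x₀ = -1` (the curtain just left of the anchoring column `0`). LEFT reads `A` on `(-∞, -1]`, `B`,
  and the plaquettes of the face columns `< 0`; RIGHT reads `A` on `[0, ∞)`, `B`, and the plaquettes of the
  face columns `≥ 0`: the shared bits are the row signs `B`. SHEAR driven by `B` (`exists_shear`;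
  `μIK`-preserving by `measurePreserving_swapSkew` / `MeasurePreserving.skew_product` and the flip invariance
  of the fair Bernoulli fields): `A ↦ A ∆ {x ≤ -1 | B 0}` and `Pf ↦ Pf ∆ {(-1, j) | B j ⊕ B (j + 1)}` (the
  face column `-1 ∉ S` reads the FAIR plaquettes). The pad TELESCOPES: its parity over the anchoring
  rectangle of a cell `(x, y)`, `x ≤ -1`, is `B 0 ⊕ B y` (`odd_telescope`), so after the shear such a cell
  is black iff `A x ⊕` (old plaquette parity) — no row sign any more — while RIGHT is unchanged. After the
  shear the two maps read DISJOINT coordinate sets, hence are independent (`RowTwistStub.indepFun_proj`);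
  transfer back along the shear (`IndepRestrict.indepFun_map_of_comp`).
* GENERAL `x₀`: the horizontal re-anchoring `exists_lift_hshift S (-1 - x₀)` is a `μIK`-preserving `Φ` with
  `blackSet {x | x - (-1 - x₀) ∈ S} (Φ ω) = blackSet S ω + (-1 - x₀, 0)`; it carries the curtain `x₀` of `S`
  to the curtain `-1` of the shifted pattern (`∌ -1`), and independence is transported along `Φ`
  (`indepFun_comp_of_map`) and the translation of the cell sets.
-/

noncomputable section

namespace Summit.CriticalPhenomena.CardyFormulaZ2.Cruxes.IKMixedBoxCrossing.DefectClosureExploration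

open scoped Classical symmDiff
open MeasureTheory ProbabilityTheory Set Function
open Literature.Probability.Percolation Literature.Probability.LatticeModels
open Summit.CriticalPhenomena.CardyFormulaZ2.Theorems.IKLinearTransport.PinnedDiagramExchange (Ω μIK blackSet parSet
  obs crsw_measurable_symmDiff_right crsw_sitePercolation_half_map_symmDiff crsw_odd_card_filter_symmDiff
  measurePreserving_swapSkew)
open Summit.CriticalPhenomena.CardyFormulaZ2.Theorems.IKLinearTransport.PinnedDiagramExchange.CouplingToLimits
  (measurable_xor measurable_mem_blackSet measurable_mem_parSet measurable_card_filter)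
open Summit.CriticalPhenomena.CardyFormulaZ2.Theorems.IKQuarterTurn (mem_Ico_min_max)
open Summit.CriticalPhenomena.CardyFormulaZ2.Cruxes.IKMixedBoxCrossing.PairedMirrorExploration (Rest νrest)
open Summit.CriticalPhenomena.CardyFormulaZ2.Cruxes.IKMixedBoxCrossing.PairedMirrorExploration.MirrorRP (μIK_eq_prod)
open Summit.CriticalPhenomena.CardyFormulaZ2.Cruxes.IKMixedBoxCrossing.PairedMirrorExploration.IndepRestrict
  (indepFun_map_of_comp)
open Summit.CriticalPhenomena.CardyFormulaZ2.Cruxes.IKMixedBoxCrossing.PairedMirrorExploration.StubPatternLocality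
  (shiftObs exists_lift_hshift)
open Summit.CriticalPhenomena.CardyFormulaZ2.Cruxes.IKMixedBoxCrossing.XorRectangleFlip.IncrStub
  (mem_parSet_congr mem_blackSet_congr)

namespace CurtainStub

/-! ## §1 Parity bookkeeping: the pad telescopes -/

/-- The faces of `I × J` in the pad `Q = {(-1, j) | B j ⊕ B (j + 1)}`: none unless `-1 ∈ I`, then the `(-1, j)`,
`j ∈ J`, with `B j ⊕ B (j + 1)` (stated for a set `Q` so that the classical decidability instance of the filter
matches its uses). -/
theorem odd_card_filter_pad (B : Set ℤ) {Q : Set (Site 2)}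
    (hQ : Q = {g : Site 2 | g 0 = -1 ∧ Xor (g 1 ∈ B) (g 1 + 1 ∈ B)}) (I J : Finset ℤ) :
    Odd ((I ×ˢ J).filter (fun f : ℤ × ℤ => (![f.1, f.2] : Site 2) ∈ Q)).card ↔
      (-1 : ℤ) ∈ I ∧ Odd (J.filter (fun j => Xor (j ∈ B) (j + 1 ∈ B))).card := by
  have h : (I ×ˢ J).filter (fun f : ℤ × ℤ => (![f.1, f.2] : Site 2) ∈ Q) =
      (I.filter (fun i => i = -1)) ×ˢ (J.filter (fun j => Xor (j ∈ B) (j + 1 ∈ B))) := by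
    ext f
    simp only [Finset.mem_filter, Finset.mem_product, hQ, Set.mem_setOf_eq, Matrix.cons_val_zero,
      Matrix.cons_val_one]
    tauto
  rw [h, Finset.card_product, Nat.odd_mul]
  by_cases hI : (-1 : ℤ) ∈ I <;> simp [Finset.filter_eq', hI]

/-- TELESCOPING along an interval: the parity of `#{j ∈ [a, a + n) | B j ⊕ B (j + 1)}` is `B a ⊕ B (a + n)`. -/
theorem odd_telescope_Ico (B : Set ℤ) (a : ℤ) (n : ℕ) :
    Odd ((Finset.Ico a (a + n)).filter (fun j => Xor (j ∈ B) (j + 1 ∈ B))).card ↔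
      Xor (a ∈ B) (a + n ∈ B) := by
  induction n with
  | zero => simp
  | succ n ih =>
    have hn : (a : ℤ) + ((n + 1 : ℕ) : ℤ) = a + n + 1 := by push_cast; ring
    rw [hn, ← Finset.insert_Ico_right_eq_Ico_add_one (by omega : a ≤ a + n), Finset.filter_insert]
    by_cases hP : Xor (a + n ∈ B) (a + n + 1 ∈ B)
    · rw [if_pos hP, Finset.card_insert_of_notMem fun h => Finset.right_notMem_Ico (Finset.mem_filter.1 h).1,
        Nat.odd_add_one, ih]
      grind
    · rw [if_neg hP, ih]
      grind

/-- TELESCOPING over the anchoring range `[min 0 y, max 0 y)`: the parity of the pad is `B 0 ⊕ B y`. -/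
theorem odd_telescope (B : Set ℤ) (y : ℤ) :
    Odd ((Finset.Ico (min 0 y) (max 0 y)).filter (fun j => Xor (j ∈ B) (j + 1 ∈ B))).card ↔
      Xor ((0 : ℤ) ∈ B) (y ∈ B) := by
  rcases le_total 0 y with hy | hy
  · rw [min_eq_left hy, max_eq_right hy]
    have h := odd_telescope_Ico B 0 y.toNat
    rwa [zero_add, Int.toNat_of_nonneg hy] at h
  · rw [min_eq_right hy, max_eq_left hy]
    have h := odd_telescope_Ico B y (-y).toNat
    rw [Int.toNat_of_nonneg (by omega : (0 : ℤ) ≤ -y), add_neg_cancel] at h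
    exact h.trans (Iff.of_eq (xor_comm _ _))

/-! ## §2 The shear (one-time pad) -/

/-- The symmetric difference of two pointwise-measurable set-valued maps is measurable. -/
theorem measurable_symmDiff' {α V : Type*} [MeasurableSpace α] {a d : α → Set V}
    (ha : ∀ v, Measurable fun p => v ∈ a p) (hd : ∀ v, Measurable fun p => v ∈ d p) :
    Measurable fun p => a p ∆ d p :=
  measurable_set_iff.2 fun v => by
    simp only [Set.mem_symmDiff]
    exact ((ha v).and (hd v).not).or ((hd v).and (ha v).not)

/-- THE SHEAR. There is a `μIK`-preserving map `T` of the gauge bits (driven by the row signs `B`: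
`A ↦ A ∆ {x ≤ -1 | B 0}`, `Pf ↦ Pf ∆ {(-1, j) | B j ⊕ B (j + 1)}`, the rest fixed; two skew products over `B` of
flips of fair Bernoulli fields on sets depending only on `B`) such that, for every pattern `S ∌ -1` (so that the
face column `-1` reads the FAIR plaquettes): a LEFT cell `v`, `v 0 ≤ -1`, is black after `T` iff `A (v 0) ⊕` (old
plaquette parity) — the row sign `B (v 1)` is cancelled by the telescoped pad and the flipped column sign — and
the RIGHT cells `v`, `v 0 ≥ 0`, keep their colours. -/
theorem exists_shear : ∃ T : Ω → Ω, MeasurePreserving T μIK μIK ∧ ∀ S : Set ℤ, (-1 : ℤ) ∉ S →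
    ∀ (ω : Ω) (v : Site 2),
      (v 0 ≤ -1 → (v ∈ blackSet S (T ω) ↔ Xor (v 0 ∈ ω.1)
        (Odd ((Finset.Ico (min 0 (v 0)) (max 0 (v 0)) ×ˢ Finset.Ico (min 0 (v 1)) (max 0 (v 1))).filter
          (fun f : ℤ × ℤ => (![f.1, f.2] : Site 2) ∈ parSet S ω)).card))) ∧
      (0 ≤ v 0 → (v ∈ blackSet S (T ω) ↔ v ∈ blackSet S ω)) := by
  let DA : Set ℤ → Set ℤ := fun B => {x | x ≤ -1 ∧ (0 : ℤ) ∈ B}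
  let DP : Set ℤ → Set (Site 2) := fun B => {g | g 0 = -1 ∧ Xor (g 1 ∈ B) (g 1 + 1 ∈ B)}
  refine ⟨fun ω => (ω.1 ∆ DA ω.2.1, (ω.2.1, (ω.2.2.1, (ω.2.2.2.1 ∆ DP ω.2.1, ω.2.2.2.2)))), ?_,
    fun S hS ω v => ?_⟩
  · -- measure preservation: skew products over the row signs
    have hGm : Measurable (uncurry fun (B : Set ℤ) (q : Set (Site 2) × (Set (Site 2) × Set (Site 2))) =>
        (q.1, (q.2.1 ∆ DP B, q.2.2))) := by
      show Measurable fun p : Rest => (p.2.1, (p.2.2.1 ∆ DP p.1, p.2.2.2))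
      refine (measurable_fst.comp measurable_snd).prodMk (Measurable.prodMk ?_
        (measurable_snd.comp (measurable_snd.comp measurable_snd)))
      exact measurable_symmDiff'
        (fun f => (measurable_set_mem f).comp (measurable_fst.comp (measurable_snd.comp measurable_snd)))
        fun f => measurable_const.and (measurable_xor ((measurable_set_mem _).comp measurable_fst)
          ((measurable_set_mem _).comp measurable_fst))
    have hF : MeasurePreserving (fun r : Rest => (id r.1, (r.2.1, (r.2.2.1 ∆ DP r.1, r.2.2.2)))) νrest νrest := by
      unfold νrest
      exact (MeasurePreserving.id _).skew_product hGm (ae_of_all _ fun B =>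
        ((MeasurePreserving.id _).prod ((⟨crsw_measurable_symmDiff_right _,
          crsw_sitePercolation_half_map_symmDiff (DP B)⟩ : MeasurePreserving (fun P : Set (Site 2) => P ∆ DP B)
            (sitePercolation (Site 2) half) (sitePercolation (Site 2) half)).prod
              (MeasurePreserving.id _))).map_eq)
    have hgm : Measurable (uncurry fun (r : Rest) (a : Set ℤ) => a ∆ DA r.1) :=
      measurable_symmDiff' (fun x => (measurable_set_mem x).comp measurable_snd)
        fun x => measurable_const.and ((measurable_set_mem (0 : ℤ)).comp (measurable_fst.comp measurable_fst))
    rw [μIK_eq_prod]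
    exact measurePreserving_swapSkew hF hgm fun r => crsw_sitePercolation_half_map_symmDiff (DA r.1)
  · -- the colours after the shear
    have hpar : parSet S ((ω.1 ∆ DA ω.2.1, (ω.2.1, (ω.2.2.1, (ω.2.2.2.1 ∆ DP ω.2.1, ω.2.2.2.2)))) : Ω) =
        parSet S ω ∆ DP ω.2.1 := by
      ext f
      simp only [parSet, Set.mem_setOf_eq, Set.mem_symmDiff, DP]
      by_cases hf : f 0 = -1
      · have hfS : f 0 ∉ S := fun h => hS (hf ▸ h)
        grind
      · grind
    simp only [blackSet, Set.mem_setOf_eq, hpar, crsw_odd_card_filter_symmDiff,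
      odd_card_filter_pad ω.2.1 (Q := DP ω.2.1) rfl, odd_telescope]
    simp only [Set.mem_symmDiff, DA, Set.mem_setOf_eq]
    constructor
    · intro hv
      have hI : (-1 : ℤ) ∈ Finset.Ico (min 0 (v 0)) (max 0 (v 0)) := by rw [mem_Ico_min_max]; omega
      grind
    · intro hv
      have hI : (-1 : ℤ) ∉ Finset.Ico (min 0 (v 0)) (max 0 (v 0)) := by rw [mem_Ico_min_max]; omega
      have hx : ¬ v 0 ≤ -1 := by omega
      grind

/-! ## §3 What the two maps read -/

/-- The sheared LEFT reads only `A` on `(-∞, -1]` and the plaquettes of the face columns `< 0`. -/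
theorem leftSh_congr (S : Set ℤ) {ω ω' : Ω} (hA : ∀ x : ℤ, x ≤ -1 → (x ∈ ω'.1 ↔ x ∈ ω.1))
    (hP : ∀ f : Site 2, f 0 < 0 → (f ∈ parSet S ω' ↔ f ∈ parSet S ω)) :
    {v : Site 2 | v 0 ≤ -1 ∧ Xor (v 0 ∈ ω'.1)
      (Odd ((Finset.Ico (min 0 (v 0)) (max 0 (v 0)) ×ˢ Finset.Ico (min 0 (v 1)) (max 0 (v 1))).filter
        (fun f : ℤ × ℤ => (![f.1, f.2] : Site 2) ∈ parSet S ω')).card)} =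
    {v : Site 2 | v 0 ≤ -1 ∧ Xor (v 0 ∈ ω.1)
      (Odd ((Finset.Ico (min 0 (v 0)) (max 0 (v 0)) ×ˢ Finset.Ico (min 0 (v 1)) (max 0 (v 1))).filter
        (fun f : ℤ × ℤ => (![f.1, f.2] : Site 2) ∈ parSet S ω)).card)} := by
  ext v
  simp only [Set.mem_setOf_eq]
  refine and_congr_right fun hv => ?_
  have hfil : ∀ f ∈ Finset.Ico (min 0 (v 0)) (max 0 (v 0)) ×ˢ Finset.Ico (min 0 (v 1)) (max 0 (v 1)),
      ((![f.1, f.2] : Site 2) ∈ parSet S ω' ↔ (![f.1, f.2] : Site 2) ∈ parSet S ω) := fun f hf => by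
    refine hP _ ?_
    have h1 := (Finset.mem_product.1 hf).1
    rw [mem_Ico_min_max] at h1
    show f.1 < 0
    omega
  rw [hA _ hv, Finset.filter_congr hfil]

/-- RIGHT reads only `A` on `[0, ∞)`, `B`, and the plaquettes of the face columns `≥ 0`. -/
theorem right_congr (S : Set ℤ) {ω ω' : Ω} (hA : ∀ x : ℤ, 0 ≤ x → (x ∈ ω'.1 ↔ x ∈ ω.1))
    (hB : ∀ y : ℤ, (y ∈ ω'.2.1 ↔ y ∈ ω.2.1)) (hP : ∀ f : Site 2, 0 ≤ f 0 → (f ∈ parSet S ω' ↔ f ∈ parSet S ω)) :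
    {v : Site 2 | -1 < v 0 ∧ v ∈ blackSet S ω'} = {v : Site 2 | -1 < v 0 ∧ v ∈ blackSet S ω} := by
  ext v
  simp only [Set.mem_setOf_eq]
  refine and_congr_right fun hv => mem_blackSet_congr S (hA _ (by omega)) (hB _) fun f hf => hP _ ?_
  rw [mem_Ico_min_max] at hf
  show 0 ≤ f.1
  omega

/-! ## §4 Measurability -/

/-- LEFT of a curtain is measurable. -/
theorem measurable_leftOf (S : Set ℤ) (x₀ : ℤ) :
    Measurable fun ω : Ω => {v : Site 2 | v 0 ≤ x₀ ∧ v ∈ blackSet S ω} :=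
  measurable_set_iff.2 fun v => measurable_const.and (measurable_mem_blackSet S v)

/-- RIGHT of a curtain is measurable. -/
theorem measurable_rightOf (S : Set ℤ) (x₀ : ℤ) :
    Measurable fun ω : Ω => {v : Site 2 | x₀ < v 0 ∧ v ∈ blackSet S ω} :=
  measurable_set_iff.2 fun v => measurable_const.and (measurable_mem_blackSet S v)

/-- The sheared LEFT is measurable. -/
theorem measurable_leftSh (S : Set ℤ) : Measurable fun ω : Ω => {v : Site 2 | v 0 ≤ -1 ∧ Xor (v 0 ∈ ω.1)
    (Odd ((Finset.Ico (min 0 (v 0)) (max 0 (v 0)) ×ˢ Finset.Ico (min 0 (v 1)) (max 0 (v 1))).filter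
      (fun f : ℤ × ℤ => (![f.1, f.2] : Site 2) ∈ parSet S ω)).card)} := by
  refine measurable_set_iff.2 fun v => measurable_const.and (measurable_xor ?_ ?_)
  · exact (measurable_set_mem (v 0)).comp measurable_fst
  · exact (measurable_of_countable fun n : ℕ => Odd n).comp
      (measurable_card_filter _ fun f => measurable_mem_parSet S _)

/-- Translating a cell set is measurable. -/
theorem measurable_shiftSet (t : Site 2) : Measurable fun X : Set (Site 2) => {u : Site 2 | u + t ∈ X} :=
  measurable_set_iff.2 fun u => measurable_set_mem (u + t)

/-! ## §5 Independence -/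

/-- The sheared LEFT and RIGHT are independent under `μIK`: they read DISJOINT coordinate sets. -/
theorem indepFun_leftSh_right (S : Set ℤ) :
    IndepFun (fun ω : Ω => {v : Site 2 | v 0 ≤ -1 ∧ Xor (v 0 ∈ ω.1)
        (Odd ((Finset.Ico (min 0 (v 0)) (max 0 (v 0)) ×ˢ Finset.Ico (min 0 (v 1)) (max 0 (v 1))).filter
          (fun f : ℤ × ℤ => (![f.1, f.2] : Site 2) ∈ parSet S ω)).card)})
      (fun ω : Ω => {v : Site 2 | -1 < v 0 ∧ v ∈ blackSet S ω}) μIK := by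
  have dA : Disjoint (Set.Iic (-1 : ℤ)) (Set.Ici 0) :=
    Set.disjoint_left.2 fun x (hx : x ≤ -1) (hx' : 0 ≤ x) => by omega
  have dB : Disjoint (∅ : Set ℤ) Set.univ := disjoint_bot_left
  have dP : Disjoint {f : Site 2 | f 0 < 0} {f : Site 2 | 0 ≤ f 0} :=
    Set.disjoint_left.2 fun f (hf : f 0 < 0) (hf' : 0 ≤ f 0) => by omega
  have dC : Disjoint (∅ : Set (Site 2)) ∅ := disjoint_bot_left
  refine ((RowTwistStub.indepFun_proj dA dB dP dP dC).comp (measurable_leftSh S) (measurable_rightOf S (-1))).congr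
    (ae_of_all _ fun ω => leftSh_congr S (fun _ hx => ⟨fun h => h.1, fun h => ⟨h, hx⟩⟩)
      fun _ hf => mem_parSet_congr S ⟨fun h => h.1, fun h => ⟨h, hf⟩⟩ ⟨fun h => h.1, fun h => ⟨h, hf⟩⟩)
    (ae_of_all _ fun ω => right_congr S (fun _ hx => ⟨fun h => h.1, fun h => ⟨h, hx⟩⟩)
      (fun _ => ⟨fun h => h.1, fun h => ⟨h, trivial⟩⟩)
      fun _ hf => mem_parSet_congr S ⟨fun h => h.1, fun h => ⟨h, hf⟩⟩ ⟨fun h => h.1, fun h => ⟨h, hf⟩⟩)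

/-- CURTAIN INDEPENDENCE at the curtain `-1 ∉ S`: shear, independence of the sheared maps, transfer back. -/
theorem indepFun_curtain_neg_one (S : Set ℤ) (hS : (-1 : ℤ) ∉ S) :
    IndepFun (fun ω : Ω => {v : Site 2 | v 0 ≤ -1 ∧ v ∈ blackSet S ω})
      (fun ω : Ω => {v : Site 2 | -1 < v 0 ∧ v ∈ blackSet S ω}) μIK := by
  obtain ⟨T, hT, hspec⟩ := exists_shear
  have hL : ∀ ω : Ω, {v : Site 2 | v 0 ≤ -1 ∧ v ∈ blackSet S (T ω)} = {v : Site 2 | v 0 ≤ -1 ∧ Xor (v 0 ∈ ω.1)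
      (Odd ((Finset.Ico (min 0 (v 0)) (max 0 (v 0)) ×ˢ Finset.Ico (min 0 (v 1)) (max 0 (v 1))).filter
        (fun f : ℤ × ℤ => (![f.1, f.2] : Site 2) ∈ parSet S ω)).card)} :=
    fun ω => Set.ext fun v => and_congr_right fun hv => (hspec S hS ω v).1 hv
  have hR : ∀ ω : Ω, {v : Site 2 | -1 < v 0 ∧ v ∈ blackSet S (T ω)} = {v : Site 2 | -1 < v 0 ∧ v ∈ blackSet S ω} :=
    fun ω => Set.ext fun v => and_congr_right fun hv => (hspec S hS ω v).2 (by omega)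
  have h := indepFun_map_of_comp hT.measurable (measurable_leftOf S (-1)) (measurable_rightOf S (-1))
    ((indepFun_leftSh_right S).congr (ae_of_all _ fun ω => (hL ω).symm) (ae_of_all _ fun ω => (hR ω).symm))
  rwa [hT.map_eq] at h

/-- Independence transfers back along a push-forward: if `f ⟂ g` under `μ.map h` then `f ∘ h ⟂ g ∘ h` under `μ`. -/
theorem indepFun_comp_of_map {α β γ δ : Type*} [MeasurableSpace α] [MeasurableSpace β] [MeasurableSpace γ]
    [MeasurableSpace δ] {μ : Measure α} {h : α → β} (hh : Measurable h) {f : β → γ} {g : β → δ}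
    (hf : Measurable f) (hg : Measurable g) (hind : IndepFun f g (μ.map h)) : IndepFun (f ∘ h) (g ∘ h) μ := by
  rw [indepFun_iff_measure_inter_preimage_eq_mul] at hind ⊢
  intro s t hs ht
  have key := hind s t hs ht
  rw [Measure.map_apply hh ((hf hs).inter (hg ht)), Measure.map_apply hh (hf hs),
    Measure.map_apply hh (hg ht)] at key
  rw [Set.preimage_comp, Set.preimage_comp, ← Set.preimage_inter]
  exact key

end CurtainStub

open CurtainStub in
/-- **Registered helper `indepFun_curtain`** (CURTAIN INDEPENDENCE, line `defect-closure-exploration`): for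
every column pattern `S` and every honeycomb face column `x₀ ∉ S`, under the gauge law `μIK` the colours of the
cell columns `≤ x₀` are independent of the colours of the cell columns `> x₀` (the fair plaquettes of the face
column `x₀` are a one-time pad between the two sides). -/
theorem indepFun_curtain : ∀ (S : Set ℤ) (x₀ : ℤ), x₀ ∉ S → ProbabilityTheory.IndepFun
    (fun ω : Ω => {v : Site 2 | v 0 ≤ x₀ ∧ v ∈ blackSet S ω})
    (fun ω : Ω => {v : Site 2 | x₀ < v 0 ∧ v ∈ blackSet S ω}) μIK := by
  intro S x₀ hx
  obtain ⟨Φ, hΦ, hobs⟩ := exists_lift_hshift S (-1 - x₀)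
  have hS' : (-1 : ℤ) ∉ {x : ℤ | x - (-1 - x₀) ∈ S} := by
    show ¬ ((-1 : ℤ) - (-1 - x₀) ∈ S)
    rw [sub_sub_cancel]
    exact hx
  have h1 := indepFun_curtain_neg_one _ hS'
  rw [← hΦ.map_eq] at h1
  have h2 := (indepFun_comp_of_map hΦ.measurable (measurable_leftOf _ (-1)) (measurable_rightOf _ (-1)) h1).comp
    (measurable_shiftSet ![-1 - x₀, 0]) (measurable_shiftSet ![-1 - x₀, 0])
  have hblack : ∀ (ω : Ω) (u : Site 2),
      (u + ![-1 - x₀, 0] ∈ blackSet {x : ℤ | x - (-1 - x₀) ∈ S} (Φ ω) ↔ u ∈ blackSet S ω) := fun ω u => by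
    have h := congrArg Prod.fst (hobs ω)
    simp only [obs, shiftObs] at h
    rw [h, Set.mem_preimage, add_sub_cancel_right]
  have h0 : ∀ u : Site 2, (u + ![-1 - x₀, 0]) 0 = u 0 + (-1 - x₀) := fun u => by
    simp only [Pi.add_apply, Matrix.cons_val_zero]
  refine h2.congr (ae_of_all _ fun ω => ?_) (ae_of_all _ fun ω => ?_)
  · ext u
    simp only [Function.comp_apply, Set.mem_setOf_eq, hblack, h0]
    exact and_congr_left fun _ => by omega
  · ext u
    simp only [Function.comp_apply, Set.mem_setOf_eq, hblack, h0]
    exact and_congr_left fun _ => by omega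

end Summit.CriticalPhenomena.CardyFormulaZ2.Cruxes.IKMixedBoxCrossing.DefectClosureExploration

end
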